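import Mathlib
import Literature.Analysis.FluidPDE.VectorCalculus
import Summits.NavierStokesRegularity.NavierStokesRegularity.Theorems.FilamentSkeletonRssClause13RAdjointEnergy

/-!
# Clause 13-R, STUB R at MODEL level: the WAIST LAW of the local adjoint equation — `w²‖φ‖²` is monotone, so a weight bounded at the
# stagnation point vanishes and every other local branch blows up at least like `1/w`
# (crux `Clause13RNearStraightL`, stmt-NavierStokesRegularity-23612; line `rate_bordered_split`, STUB R `stub_rateRow13RFlat`)

Route `FilamentSkeletonRss`, Variant A1R.  The annihilators of the linearised normal-velocity map on CLAMPED test fields (the objects the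
edge-measure certificate `…Clause13REdgeMeasureCertificate` feeds on) are, in the MODEL of `…Clause13RAdjointStraightModelWeights` / `…Clause13RAdjointEnergy`,
measures whose density solves the adjoint transport equation
  `w σ φ′ σ + (½ + w′ σ) φ σ + α e × φ σ + cst·m σ (φ σ × d) = g σ`,
`g` = the (bounded, continuous) nonlocal term plus edge sources, with the slip `w` vanishing at the waist station `c` (`w′(c) = κ ≥ 3/2 + δ`).
THIS FILE records the exact local law at the waist for the HOMOGENEOUS local equation (`g = 0`), which is what decides which local branches a
finite measure can carry:

* `model_adjoint_waist_law_right` / `_left` — pairing the equation with `φ` kills the two skew terms (`⟪e × φ, φ⟫ = ⟪φ × d, φ⟫ = 0`) and gives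
  `w⟪φ′, φ⟫ = −(½ + w′)‖φ‖²`, whence `(w²‖φ‖²)′ = −w‖φ‖²`: the quantity `w²‖φ‖²` is NON-INCREASING where `w ≥ 0` (right of the waist) and
  NON-DECREASING where `w ≤ 0` (left of the waist) — no sign condition on `w′` is needed;
* `eq_zero_of_waist_right` / `_left` — hence a solution that is `C¹` up to the waist (`w(c) = 0`) VANISHES at every station of the half-ball where
  `w ≠ 0`: the homogeneous local equation has NO nonzero branch bounded at the stagnation point;
* `waist_blowup_right` / `_left` — and every solution obeys `|w(σ₁)|·‖φ(σ₁)‖ ≤ |w(σ)|·‖φ(σ)‖` for `σ` between the waist and `σ₁`: a nonzero local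
  branch blows up at least like `|w(σ₁)|‖φ(σ₁)‖/|w(σ)| ≍ 1/(κ|σ − c|)`, which is NOT integrable at `c`.
Consequences (memo DIAG-23612-R-currency-leafhand19-g0.md §3, planner-facing): with the nonlocal term treated as a bounded source, an `L¹` annihilating
density is on each side of the waist the unique bounded branch; a WAIST ATOM `e_c δ_c` would source a jump of `wφ`, i.e. a `1/w` branch, whose mass is
log-divergent — so neither singular densities nor waist atoms enlarge the 4-parameter EDGE cokernel of hand fsrs-16-g0; together with
`…Clause13RAdjointEnergy.model_adjoint_no_regular_annihilator` (no `C¹` density) and `…Clause13RAdjointPiecewise` (no density kinked/jumping at the waist)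
this is the model-level statement «the rate row of 13-R is pure EDGE information».  [folklore] (energy/virial identity for a transport operator with
skew zeroth-order part at a stagnation point).
Hand `leafhand-ns-filamentskeletonrs-19-g0` (LAND-ONLY); `--supports stmt-NavierStokesRegularity-23612` helper, def-free.  HONEST FRAMING: an ODE identity
for the MODEL adjoint equation attached to a HYPOTHETICAL filament skeleton on the NEGATIVE side of a MODEL blow-up route; STUB R is NOT proved here and
nothing in this file bears on Navier–Stokes regularity or blow-up.
-/

noncomputable section

open MeasureTheory Filter Topology Set
open scoped RealInnerProductSpace InnerProductSpace
open Literature.Analysis.FluidPDE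
open Summit.NavierStokesRegularity.NavierStokesRegularity.Theorems.Clause13RAdjointEnergy (inner_cross_left_swap)

namespace Summit.NavierStokesRegularity.NavierStokesRegularity.Theorems.Clause13RAdjointWaistLaw
set_option linter.dupNamespace false

/-! ## §1 The pointwise identity `w⟪φ′, φ⟫ = −(½ + w′)‖φ‖²` and the derivative of `w²‖φ‖²`
(the orthogonalities `⟪e × x, x⟫ = 0 = ⟪x × d, x⟫` are the landed `DepletionLadder.inner_cross_curl_self` / `inner_cross_curl_left`;
they are re-derived inline, as in `…Clause13RAdjointEnergy`, to keep this file's imports minimal) -/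

/-- Pairing the homogeneous local adjoint equation with `φ σ`: the skew terms drop and `w⟪φ′, φ⟫ = −(½ + w′)‖φ‖²`. [folklore] -/
theorem inner_deriv_of_local_eq {cst α : ℝ} {m w w' : ℝ → ℝ} {φ φ' : ℝ → EuclideanSpace ℝ (Fin 3)}
    {d e : EuclideanSpace ℝ (Fin 3)} {σ : ℝ}
    (heq : w σ • φ' σ + (1 / 2 : ℝ) • φ σ + w' σ • φ σ + α • cross e (φ σ) + (cst * m σ) • cross (φ σ) d = 0) :
    w σ * ⟪φ' σ, φ σ⟫ = -(1 / 2 + w' σ) * ‖φ σ‖ ^ 2 := by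
  have he : ⟪cross e (φ σ), φ σ⟫ = 0 := by
    simp only [cross, cross_apply, PiLp.inner_apply, RCLike.inner_apply, conj_trivial, Fin.sum_univ_three,
      Matrix.cons_val_zero, Matrix.cons_val_one, Matrix.cons_val_two, Matrix.head_cons, Matrix.tail_cons]
    ring
  have hd : ⟪cross (φ σ) d, φ σ⟫ = 0 := by
    have h := inner_cross_left_swap (φ σ) (φ σ) d
    linarith
  have h := congrArg (fun v => ⟪v, φ σ⟫) heq
  simp only [inner_add_left, inner_smul_left, conj_trivial, he, hd,
    real_inner_self_eq_norm_sq, mul_zero, add_zero, inner_zero_left] at h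
  linarith

/-- The derivative of `σ ↦ w(σ)²‖φ(σ)‖²` along a solution of the homogeneous local adjoint equation is `−w(σ)‖φ(σ)‖²`. [folklore] -/
theorem hasDerivAt_wsq_normsq {cst α : ℝ} {m w w' : ℝ → ℝ} {φ φ' : ℝ → EuclideanSpace ℝ (Fin 3)}
    {d e : EuclideanSpace ℝ (Fin 3)} {σ : ℝ} (hw : HasDerivAt w (w' σ) σ) (hφ : HasDerivAt φ (φ' σ) σ)
    (heq : w σ • φ' σ + (1 / 2 : ℝ) • φ σ + w' σ • φ σ + α • cross e (φ σ) + (cst * m σ) • cross (φ σ) d = 0) :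
    HasDerivAt (fun s => w s ^ 2 * ‖φ s‖ ^ 2) (-(w σ * ‖φ σ‖ ^ 2)) σ := by
  have h1 : HasDerivAt (fun s => w s ^ 2) (2 * w σ * w' σ) σ :=
    (hw.fun_pow 2).congr_deriv (by norm_num)
  have h2 : HasDerivAt (fun s => ‖φ s‖ ^ 2) (2 * ⟪φ σ, φ' σ⟫) σ := hφ.norm_sq
  have h3 := h1.mul h2
  have hkey := inner_deriv_of_local_eq heq
  have hval : 2 * w σ * w' σ * ‖φ σ‖ ^ 2 + w σ ^ 2 * (2 * ⟪φ σ, φ' σ⟫) = -(w σ * ‖φ σ‖ ^ 2) := by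
    have : w σ ^ 2 * (2 * ⟪φ σ, φ' σ⟫) = 2 * w σ * (w σ * ⟪φ' σ, φ σ⟫) := by rw [real_inner_comm]; ring
    rw [this, hkey]; ring
  rw [← hval]
  exact h3

/-! ## §2 The waist law: monotonicity of `w²‖φ‖²` on either side of the stagnation point -/

/-- **WAIST LAW, right of the waist.**  If `φ ∈ C¹` solves the homogeneous local adjoint equation on `[c, σ₁]` and `w ≥ 0` there, then
`σ ↦ w(σ)²‖φ(σ)‖²` is non-increasing on `[c, σ₁]`. [folklore] -/
theorem model_adjoint_waist_law_right {c σ₁ cst α : ℝ} {m w w' : ℝ → ℝ} {φ φ' : ℝ → EuclideanSpace ℝ (Fin 3)}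
    {d e : EuclideanSpace ℝ (Fin 3)} (hw : ∀ σ, HasDerivAt w (w' σ) σ) (hφ : ∀ σ, HasDerivAt φ (φ' σ) σ)
    (hwnn : ∀ σ ∈ Icc c σ₁, 0 ≤ w σ)
    (heq : ∀ σ ∈ Icc c σ₁, w σ • φ' σ + (1 / 2 : ℝ) • φ σ + w' σ • φ σ + α • cross e (φ σ) + (cst * m σ) • cross (φ σ) d = 0) :
    AntitoneOn (fun s => w s ^ 2 * ‖φ s‖ ^ 2) (Icc c σ₁) := by
  have hwc : Continuous w := continuous_iff_continuousAt.2 fun σ => (hw σ).continuousAt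
  have hφc : Continuous φ := continuous_iff_continuousAt.2 fun σ => (hφ σ).continuousAt
  have hcont : Continuous fun s => w s ^ 2 * ‖φ s‖ ^ 2 := (hwc.pow 2).mul (hφc.norm.pow 2)
  refine antitoneOn_of_deriv_nonpos (convex_Icc c σ₁) hcont.continuousOn ?_ ?_
  · intro σ hσ
    rw [interior_Icc] at hσ
    exact (hasDerivAt_wsq_normsq (hw σ) (hφ σ) (heq σ (Ioo_subset_Icc_self hσ))).differentiableAt.differentiableWithinAt
  · intro σ hσ
    rw [interior_Icc] at hσ
    rw [(hasDerivAt_wsq_normsq (hw σ) (hφ σ) (heq σ (Ioo_subset_Icc_self hσ))).deriv]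
    have := hwnn σ (Ioo_subset_Icc_self hσ)
    have : 0 ≤ w σ * ‖φ σ‖ ^ 2 := mul_nonneg this (sq_nonneg _)
    linarith

/-- **WAIST LAW, left of the waist.**  If `φ ∈ C¹` solves the homogeneous local adjoint equation on `[σ₁, c]` and `w ≤ 0` there, then
`σ ↦ w(σ)²‖φ(σ)‖²` is non-decreasing on `[σ₁, c]`. [folklore] -/
theorem model_adjoint_waist_law_left {σ₁ c cst α : ℝ} {m w w' : ℝ → ℝ} {φ φ' : ℝ → EuclideanSpace ℝ (Fin 3)}
    {d e : EuclideanSpace ℝ (Fin 3)} (hw : ∀ σ, HasDerivAt w (w' σ) σ) (hφ : ∀ σ, HasDerivAt φ (φ' σ) σ)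
    (hwnp : ∀ σ ∈ Icc σ₁ c, w σ ≤ 0)
    (heq : ∀ σ ∈ Icc σ₁ c, w σ • φ' σ + (1 / 2 : ℝ) • φ σ + w' σ • φ σ + α • cross e (φ σ) + (cst * m σ) • cross (φ σ) d = 0) :
    MonotoneOn (fun s => w s ^ 2 * ‖φ s‖ ^ 2) (Icc σ₁ c) := by
  have hwc : Continuous w := continuous_iff_continuousAt.2 fun σ => (hw σ).continuousAt
  have hφc : Continuous φ := continuous_iff_continuousAt.2 fun σ => (hφ σ).continuousAt
  have hcont : Continuous fun s => w s ^ 2 * ‖φ s‖ ^ 2 := (hwc.pow 2).mul (hφc.norm.pow 2)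
  refine monotoneOn_of_deriv_nonneg (convex_Icc σ₁ c) hcont.continuousOn ?_ ?_
  · intro σ hσ
    rw [interior_Icc] at hσ
    exact (hasDerivAt_wsq_normsq (hw σ) (hφ σ) (heq σ (Ioo_subset_Icc_self hσ))).differentiableAt.differentiableWithinAt
  · intro σ hσ
    rw [interior_Icc] at hσ
    rw [(hasDerivAt_wsq_normsq (hw σ) (hφ σ) (heq σ (Ioo_subset_Icc_self hσ))).deriv]
    have := hwnp σ (Ioo_subset_Icc_self hσ)
    have : w σ * ‖φ σ‖ ^ 2 ≤ 0 := mul_nonpos_of_nonpos_of_nonneg this (sq_nonneg _)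
    linarith

/-! ## §3 Consequences: no branch bounded at the waist; every branch blows up at least like `1/w` -/

/-- **No nonzero branch bounded at the stagnation point (right half-ball).**  With `w(c) = 0`, `w ≥ 0` on `[c, σ₁]`, a `C¹` solution on `[c, σ₁]`
vanishes at every station `σ ∈ [c, σ₁]` with `w(σ) ≠ 0`. [folklore] -/
theorem eq_zero_of_waist_right {c σ₁ cst α : ℝ} {m w w' : ℝ → ℝ} {φ φ' : ℝ → EuclideanSpace ℝ (Fin 3)}
    {d e : EuclideanSpace ℝ (Fin 3)} (hw : ∀ σ, HasDerivAt w (w' σ) σ) (hφ : ∀ σ, HasDerivAt φ (φ' σ) σ)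
    (hwc : w c = 0) (hwnn : ∀ σ ∈ Icc c σ₁, 0 ≤ w σ)
    (heq : ∀ σ ∈ Icc c σ₁, w σ • φ' σ + (1 / 2 : ℝ) • φ σ + w' σ • φ σ + α • cross e (φ σ) + (cst * m σ) • cross (φ σ) d = 0)
    {σ : ℝ} (hσ : σ ∈ Icc c σ₁) (hwσ : w σ ≠ 0) : φ σ = 0 := by
  have hA := model_adjoint_waist_law_right hw hφ hwnn heq
  have hcmem : c ∈ Icc c σ₁ := ⟨le_rfl, hσ.1.trans hσ.2⟩
  have hle : w σ ^ 2 * ‖φ σ‖ ^ 2 ≤ w c ^ 2 * ‖φ c‖ ^ 2 := hA hcmem hσ hσ.1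
  rw [hwc] at hle
  simp only [ne_eq, OfNat.ofNat_ne_zero, not_false_eq_true, zero_pow, zero_mul] at hle
  have hnn : 0 ≤ w σ ^ 2 * ‖φ σ‖ ^ 2 := mul_nonneg (sq_nonneg _) (sq_nonneg _)
  have h0 : w σ ^ 2 * ‖φ σ‖ ^ 2 = 0 := le_antisymm hle hnn
  rcases mul_eq_zero.mp h0 with h | h
  · exact absurd (pow_eq_zero_iff (n := 2) (by norm_num) |>.mp h) hwσ
  · exact norm_eq_zero.mp (pow_eq_zero_iff (n := 2) (by norm_num) |>.mp h)

/-- **No nonzero branch bounded at the stagnation point (left half-ball).** [folklore] -/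
theorem eq_zero_of_waist_left {σ₁ c cst α : ℝ} {m w w' : ℝ → ℝ} {φ φ' : ℝ → EuclideanSpace ℝ (Fin 3)}
    {d e : EuclideanSpace ℝ (Fin 3)} (hw : ∀ σ, HasDerivAt w (w' σ) σ) (hφ : ∀ σ, HasDerivAt φ (φ' σ) σ)
    (hwc : w c = 0) (hwnp : ∀ σ ∈ Icc σ₁ c, w σ ≤ 0)
    (heq : ∀ σ ∈ Icc σ₁ c, w σ • φ' σ + (1 / 2 : ℝ) • φ σ + w' σ • φ σ + α • cross e (φ σ) + (cst * m σ) • cross (φ σ) d = 0)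
    {σ : ℝ} (hσ : σ ∈ Icc σ₁ c) (hwσ : w σ ≠ 0) : φ σ = 0 := by
  have hM := model_adjoint_waist_law_left hw hφ hwnp heq
  have hcmem : c ∈ Icc σ₁ c := ⟨hσ.1.trans hσ.2, le_rfl⟩
  have hle : w σ ^ 2 * ‖φ σ‖ ^ 2 ≤ w c ^ 2 * ‖φ c‖ ^ 2 := hM hσ hcmem hσ.2
  rw [hwc] at hle
  simp only [ne_eq, OfNat.ofNat_ne_zero, not_false_eq_true, zero_pow, zero_mul] at hle
  have hnn : 0 ≤ w σ ^ 2 * ‖φ σ‖ ^ 2 := mul_nonneg (sq_nonneg _) (sq_nonneg _)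
  have h0 : w σ ^ 2 * ‖φ σ‖ ^ 2 = 0 := le_antisymm hle hnn
  rcases mul_eq_zero.mp h0 with h | h
  · exact absurd (pow_eq_zero_iff (n := 2) (by norm_num) |>.mp h) hwσ
  · exact norm_eq_zero.mp (pow_eq_zero_iff (n := 2) (by norm_num) |>.mp h)

/-- **Blow-up of every branch (right half-ball).**  For a `C¹` solution on `[c, σ₁]` with `w ≥ 0` there: `w(σ₁)‖φ(σ₁)‖ ≤ w(σ)‖φ(σ)‖` for all
`σ ∈ [c, σ₁]`; in particular a branch with `φ(σ₁) ≠ 0`, `w(σ₁) > 0` satisfies `‖φ(σ)‖ ≥ w(σ₁)‖φ(σ₁)‖/w(σ)` as `σ ↓ c` — for a slip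
`w(σ) ≤ κ₂(σ − c)` this is `≳ 1/(σ − c)`, NOT integrable at the waist. [folklore] -/
theorem waist_blowup_right {c σ₁ cst α : ℝ} {m w w' : ℝ → ℝ} {φ φ' : ℝ → EuclideanSpace ℝ (Fin 3)}
    {d e : EuclideanSpace ℝ (Fin 3)} (hw : ∀ σ, HasDerivAt w (w' σ) σ) (hφ : ∀ σ, HasDerivAt φ (φ' σ) σ)
    (hwnn : ∀ σ ∈ Icc c σ₁, 0 ≤ w σ)
    (heq : ∀ σ ∈ Icc c σ₁, w σ • φ' σ + (1 / 2 : ℝ) • φ σ + w' σ • φ σ + α • cross e (φ σ) + (cst * m σ) • cross (φ σ) d = 0)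
    {σ : ℝ} (hσ : σ ∈ Icc c σ₁) : w σ₁ * ‖φ σ₁‖ ≤ w σ * ‖φ σ‖ := by
  have hA := model_adjoint_waist_law_right hw hφ hwnn heq
  have h1mem : σ₁ ∈ Icc c σ₁ := ⟨hσ.1.trans hσ.2, le_rfl⟩
  have hle : w σ₁ ^ 2 * ‖φ σ₁‖ ^ 2 ≤ w σ ^ 2 * ‖φ σ‖ ^ 2 := hA hσ h1mem hσ.2
  have ha : 0 ≤ w σ₁ * ‖φ σ₁‖ := mul_nonneg (hwnn σ₁ h1mem) (norm_nonneg _)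
  have hb : 0 ≤ w σ * ‖φ σ‖ := mul_nonneg (hwnn σ hσ) (norm_nonneg _)
  have hle' : (w σ₁ * ‖φ σ₁‖) ^ 2 ≤ (w σ * ‖φ σ‖) ^ 2 := by rw [mul_pow, mul_pow]; exact hle
  exact (sq_le_sq₀ ha hb).mp hle'

/-- **Blow-up of every branch (left half-ball).**  For a `C¹` solution on `[σ₁, c]` with `w ≤ 0` there: `|w(σ₁)|‖φ(σ₁)‖ ≤ |w(σ)|‖φ(σ)‖`
for all `σ ∈ [σ₁, c]`. [folklore] -/
theorem waist_blowup_left {σ₁ c cst α : ℝ} {m w w' : ℝ → ℝ} {φ φ' : ℝ → EuclideanSpace ℝ (Fin 3)}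
    {d e : EuclideanSpace ℝ (Fin 3)} (hw : ∀ σ, HasDerivAt w (w' σ) σ) (hφ : ∀ σ, HasDerivAt φ (φ' σ) σ)
    (hwnp : ∀ σ ∈ Icc σ₁ c, w σ ≤ 0)
    (heq : ∀ σ ∈ Icc σ₁ c, w σ • φ' σ + (1 / 2 : ℝ) • φ σ + w' σ • φ σ + α • cross e (φ σ) + (cst * m σ) • cross (φ σ) d = 0)
    {σ : ℝ} (hσ : σ ∈ Icc σ₁ c) : |w σ₁| * ‖φ σ₁‖ ≤ |w σ| * ‖φ σ‖ := by
  have hM := model_adjoint_waist_law_left hw hφ hwnp heq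
  have h1mem : σ₁ ∈ Icc σ₁ c := ⟨le_rfl, hσ.1.trans hσ.2⟩
  have hle : w σ₁ ^ 2 * ‖φ σ₁‖ ^ 2 ≤ w σ ^ 2 * ‖φ σ‖ ^ 2 := hM h1mem hσ hσ.1
  have ha : 0 ≤ |w σ₁| * ‖φ σ₁‖ := mul_nonneg (abs_nonneg _) (norm_nonneg _)
  have hb : 0 ≤ |w σ| * ‖φ σ‖ := mul_nonneg (abs_nonneg _) (norm_nonneg _)
  have hle' : (|w σ₁| * ‖φ σ₁‖) ^ 2 ≤ (|w σ| * ‖φ σ‖) ^ 2 := by rw [mul_pow, mul_pow, sq_abs, sq_abs]; exact hle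
  exact (sq_le_sq₀ ha hb).mp hle'

end Summit.NavierStokesRegularity.NavierStokesRegularity.Theorems.Clause13RAdjointWaistLaw

end
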